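import Mathlib.Data.Real.Basic
import Mathlib.Algebra.BigOperators.Group.Finset.Basic
import Mathlib.Tactic
import HarnessLib

/-!
# Format C, design C∞: the window's BOUNDARY CONDITIONS as integer identities (rung slots `hbe` / `hbo`)

Route context: Fourier–Galerkin / Schur-complement certificates of Weil positivity on a window ("format C", C∞ door
`WeilFormatC.weilPositivityOn_of_cinf_pipeline`; cell memo `run/shared/lean/pub/rh-explicit/rh-explicit-weil-10/KERNEL-LEVER.md` §24;
supporting stmt-RiemannHypothesis-0098; seat rh-explicit-weil-10).  The door takes the profile coefficients `coef : Fin r → ℕ → ℝ` of the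
window polynomials `Σ_{q ∈ se} coef j q x^q` together with the boundary conditions
`hbe : ∀ j, Σ_{q ∈ se} coef j q · q · a^{q−1} = 0` (even sector: `p′(a) = 0`) and `hbo : ∀ j, Σ_{q ∈ so} coef j q · a^q = 0` (odd: `p(a) = 0`).
In a rung the coefficients are exact dyadics `coef j q = Z j q / 2^c` (rh-explicit-weil-2's integer table `CON`) and the window is rational,
`a = p/s`; then both conditions are INTEGER identities over the power LIST, decidable by the kernel:

* `cinf_boundary_even_of_int` — `Σ_{q∈l} Z j q · q · p^{q−1} · s^{Q−(q−1)} = 0` (every `q ≤ Q+1`) ⇒ `hbe` on `se := l.toFinset`;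
* `cinf_boundary_odd_of_int`  — `Σ_{q∈l} Z j q · p^q · s^{Q−q} = 0` (every `q ≤ Q`) ⇒ `hbo` on `so := l.toFinset`.

Elementary algebra; standard axioms; no RH claim.
-/

set_option autoImplicit false
set_option linter.dupNamespace false

open Finset
open scoped BigOperators

namespace Summit.RiemannHypothesis.RiemannHypothesis.Theorems.WeilFormatC

/-- One term: `Z/2^c · w · (p/s)^e = (Z · w · p^e · s^{Q−e}) / (2^c · s^Q)` for `e ≤ Q`. -/
private theorem dyadic_term_eq (Z : ℤ) (c : ℕ) (w : ℝ) {p s : ℕ} (hs : 0 < s) {e Q : ℕ} (he : e ≤ Q) :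
    (Z : ℝ) / 2 ^ c * w * ((p : ℝ) / s) ^ e
      = ((Z : ℝ) * w * (p : ℝ) ^ e * (s : ℝ) ^ (Q - e)) / (2 ^ c * (s : ℝ) ^ Q) := by
  have hs' : (s : ℝ) ≠ 0 := by positivity
  have hsQ : (s : ℝ) ^ Q = (s : ℝ) ^ e * (s : ℝ) ^ (Q - e) := by rw [← pow_add, Nat.add_sub_cancel' he]
  rw [div_pow, hsQ]
  field_simp

/-- **Even boundary condition from an integer identity.**  If `coef j q = Z j q / 2^c` on the duplicate-free power list `l`,
`a = p/s` with `0 < s`, every `q ∈ l` has `q ≤ Q + 1`, and `Σ_{q∈l} Z j q · q · p^{q−1} · s^{Q−(q−1)} = 0` in `ℤ` for every `j`, then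
`Σ_{q ∈ l.toFinset} coef j q · q · a^{q−1} = 0` — the door's `hbe`. -/
theorem cinf_boundary_even_of_int {r : ℕ} {l : List ℕ} (hl : l.Nodup) (Z : Fin r → ℕ → ℤ) (c : ℕ) {a : ℝ} {p s : ℕ}
    (ha : a = (p : ℝ) / s) (hs : 0 < s) (coef : Fin r → ℕ → ℝ) (hcoef : ∀ j, ∀ q ∈ l, coef j q = (Z j q : ℝ) / 2 ^ c)
    (Q : ℕ) (hQ : ∀ q ∈ l, q ≤ Q + 1)
    (hZ : ∀ j, (l.map fun q ↦ Z j q * (q : ℤ) * (p : ℤ) ^ (q - 1) * (s : ℤ) ^ (Q - (q - 1))).sum = 0) :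
    ∀ j, ∑ q ∈ l.toFinset, coef j q * q * a ^ (q - 1) = 0 := by
  intro j
  have hterm : ∀ q ∈ l.toFinset, coef j q * q * a ^ (q - 1)
      = ((Z j q * (q : ℤ) * (p : ℤ) ^ (q - 1) * (s : ℤ) ^ (Q - (q - 1)) : ℤ) : ℝ) / (2 ^ c * (s : ℝ) ^ Q) := by
    intro q hq
    rw [List.mem_toFinset] at hq
    rw [hcoef j q hq, ha]
    push_cast
    have hq' := hQ q hq
    exact dyadic_term_eq (Z j q) c (q : ℝ) (p := p) hs (by omega)
  rw [Finset.sum_congr rfl hterm, ← Finset.sum_div, div_eq_zero_iff]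
  left
  have hZ' : ∑ q ∈ l.toFinset, (Z j q * (q : ℤ) * (p : ℤ) ^ (q - 1) * (s : ℤ) ^ (Q - (q - 1))) = 0 := by
    rw [List.sum_toFinset _ hl]; exact hZ j
  exact_mod_cast hZ'

/-- **Odd boundary condition from an integer identity.**  If `coef j q = Z j q / 2^c` on the duplicate-free power list `l`,
`a = p/s` with `0 < s`, every `q ∈ l` has `q ≤ Q`, and `Σ_{q∈l} Z j q · p^q · s^{Q−q} = 0` in `ℤ` for every `j`, then
`Σ_{q ∈ l.toFinset} coef j q · a^q = 0` — the door's `hbo`. -/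
theorem cinf_boundary_odd_of_int {r : ℕ} {l : List ℕ} (hl : l.Nodup) (Z : Fin r → ℕ → ℤ) (c : ℕ) {a : ℝ} {p s : ℕ}
    (ha : a = (p : ℝ) / s) (hs : 0 < s) (coef : Fin r → ℕ → ℝ) (hcoef : ∀ j, ∀ q ∈ l, coef j q = (Z j q : ℝ) / 2 ^ c)
    (Q : ℕ) (hQ : ∀ q ∈ l, q ≤ Q)
    (hZ : ∀ j, (l.map fun q ↦ Z j q * (p : ℤ) ^ q * (s : ℤ) ^ (Q - q)).sum = 0) :
    ∀ j, ∑ q ∈ l.toFinset, coef j q * a ^ q = 0 := by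
  intro j
  have hterm : ∀ q ∈ l.toFinset, coef j q * a ^ q
      = ((Z j q * (p : ℤ) ^ q * (s : ℤ) ^ (Q - q) : ℤ) : ℝ) / (2 ^ c * (s : ℝ) ^ Q) := by
    intro q hq
    rw [List.mem_toFinset] at hq
    rw [hcoef j q hq, ha]
    have h := dyadic_term_eq (Z j q) c 1 (p := p) hs (hQ q hq)
    rw [mul_one] at h
    push_cast
    rw [h, mul_one]
  rw [Finset.sum_congr rfl hterm, ← Finset.sum_div, div_eq_zero_iff]
  left
  have hZ' : ∑ q ∈ l.toFinset, (Z j q * (p : ℤ) ^ q * (s : ℤ) ^ (Q - q)) = 0 := by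
    rw [List.sum_toFinset _ hl]; exact hZ j
  exact_mod_cast hZ'

end Summit.RiemannHypothesis.RiemannHypothesis.Theorems.WeilFormatC
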